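import Summits.ResolutionOfSingularities.ResolutionOfSingularities.Theorems.FrobeniusClosingDefs
import Summits.ResolutionOfSingularities.ResolutionOfSingularities.Theorems.JacobianBudgetDefs

/-!
# Route `FrobeniusClosing`, crux `BoundedMilnor` (stmt-ResolutionOfSingularities-16346) — the stub
# statements of line `jacobian-budget` (lead's skeleton v2) as named propositions

The crux `Theses.FrobeniusClosing.BoundedMilnor` shares its thirteen `let`-bound definitions VERBATIM with
the sibling routes `JacobianBudget` / `WildCones`; they are the landed Theorems-side calculus
`Theorems/WildConesClassicalRegimesDefs.lean` (namespace `…Theorems.WildCones`, explicit arguments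
`p n κ`), and the sibling crux `JacobianBudget.IsolatedJacobianDrop` (stmt-18946, line `euler-noether`)
has landed `Theorems/JacobianBudgetDefs.lean` with the shared engine statements (`BaseChange`,
`NoExcess`, `PolarAdditivity`, `MixedNoether`) and vocabulary (`form`, `ExcFinite`, `pt`, `NF`, `locT`).
Line `jacobian-budget` of crux `BoundedMilnor` (`Cruxes/BoundedMilnor/Lines/jacobian_budget.lean`, lead's
skeleton v2, 2026-08-17) consumes those and cuts the budget ARGUMENT (the sibling's monolithic
`stub_budgetOfEngines`) into the kits stated here:

* `TransformKit` — the Euler transform identities for a general exceptional point `(i, τ)` through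
  `FrobeniusClosing.chartMap`, and the restriction of the successor's partials to the exceptional divisor;
* `AutKit` — covariance of `Isol`, `MultP`, `mu`, of the successor `mu`'s (explicit action of the linear
  part on exceptional points) and of the two lowest forms under a formal automorphism of `L⟦u⟧`;
* `GaussAvoidance` — for forms `Φ` (degree `p = char`), `Ψ ≠ 0` with `V(∂Φ, Ψ)` finite, a linear change
  of coordinates keeps `Ψ| ≠ 0` and `V(∂(Φ|), Ψ|)` finite on the last coordinate hyperplane;
* `SectionKit` — graph elimination `L⟦u', u_N⟧/(I, u_N − η) ≅ L⟦u'⟧/I(u', η)`, the formal implicit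
  function, tangential derivatives when `dη = 0`, and finite prime avoidance for
  `(∂_{j<N} a, u_N + λ(∂_N a)^{2p})`;
* `OnePointBudget` — the Δ-free one-point conservation inequality `mu (step i τ c) ≤ mu c` under
  `ExcFinite` (what the crux needs; the sibling's `ExceptionalBudget` is the summed form with `Δ_n(p)`);

and their by-stub-name aliases `Sig.stub_<name>`. They live under `Theorems/` so that the stub files
`Theorems/FrobeniusClosingBoundedMilnor….lean` can import them — the arrangement of
`Theorems/FrobeniusClosingDefs.lean` / `Theorems/JacobianBudgetDefs.lean`. Namespace
`…Theorems.BoundedMilnorBudget` (not under `…FrobeniusClosing`, whose own copy of the calculus would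
shadow the `WildCones` names). No theorem is proved here. Nothing here is a published result: the Props
are route-posited sub-statements of the line (informal sources: Fulton, *Intersection Theory*, Ex. 12.4.8;
Teissier, Astérisque 7–8 (1973) §II; Greuel–Lossen–Shustin, *Introduction to Singularities and
Deformations*, §I.1–I.2).
-/

-- single-problem summit: the doubled namespace component `ResolutionOfSingularities` is forced
set_option linter.dupNamespace false

noncomputable section

open scoped BigOperators Classical

open Summit.ResolutionOfSingularities.ResolutionOfSingularities.Theorems.WildCones
  (clean bl ord dv tr step run ser pd jac Isol MultP mu)
open Summit.ResolutionOfSingularities.ResolutionOfSingularities.Theorems.JacobianBudget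
  (form ExcFinite pt NF locT PolarAdditivity MixedNoether)
open Summit.ResolutionOfSingularities.ResolutionOfSingularities.Theorems.FrobeniusClosing (chartMap)

namespace Summit.ResolutionOfSingularities.ResolutionOfSingularities.Theorems.BoundedMilnorBudget

/-! ## Small vocabulary of the kits (named, so that the statements below read as in the line card) -/

section Vocabulary
variable {n : ℕ} {L : Type} [Field L]

/-- evaluation of a polynomial in the homogeneous coordinates at the affine chart `u_i = 1` translated by
`τ` (`u_l ↦ u_l + τ_l` for `l ≠ i`, `u_i ↦ 1`), read as a power series. [folklore] -/
def evE (i : Fin n) (τ : Fin n → L) (P : MvPolynomial (Fin n) L) : MvPowerSeries (Fin n) L :=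
  ((MvPolynomial.aeval (fun l => if l = i then (1 : MvPolynomial (Fin n) L)
    else MvPolynomial.X l + MvPolynomial.C (τ l)) P : MvPolynomial (Fin n) L) : MvPowerSeries (Fin n) L)

/-- the linear substitution `X_j ↦ Σ_l A j l · X_l` on polynomials. [folklore] -/
def linSubst (A : Matrix (Fin n) (Fin n) L) (P : MvPolynomial (Fin n) L) : MvPolynomial (Fin n) L :=
  MvPolynomial.aeval (fun j => ∑ l, MvPolynomial.C (A j l) * MvPolynomial.X l) P

/-- the linear part (Jacobian matrix at the origin) of a substitution `Φ`: `A j l =` coefficient of `u_l`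
in `Φ j`. [folklore] -/
def linPart (Φ : Fin n → MvPowerSeries (Fin n) L) : Matrix (Fin n) (Fin n) L :=
  Matrix.of fun j l => MvPowerSeries.coeff (Finsupp.single l 1) (Φ j)

/-- the quadratic part of the `j`-th component of a substitution, as a polynomial. [folklore] -/
def quadPart (Φ : Fin n → MvPowerSeries (Fin n) L) (j : Fin n) : MvPolynomial (Fin n) L :=
  ∑ B ∈ Finset.Nat.antidiagonalTuple n 2,
    MvPolynomial.monomial (Finsupp.equivFunOnFinite.symm B)
      (MvPowerSeries.coeff (Finsupp.equivFunOnFinite.symm B) (Φ j))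

/-- the state `c ∘ Φ`: coefficient function of `(ser c)(Φ)`. [folklore] -/
def compState (p : ℕ) (c : (Fin n → ℕ) → L) (Φ : Fin n → MvPowerSeries (Fin n) L) : (Fin n → ℕ) → L :=
  fun B => MvPowerSeries.coeff (Finsupp.equivFunOnFinite.symm B) (MvPowerSeries.subst Φ (ser p n L c))

/-- restriction of a polynomial in `m + 1` variables to the last coordinate hyperplane `X_last = 0`.
[folklore] -/
def resLast {m : ℕ} (P : MvPolynomial (Fin (m + 1)) L) : MvPolynomial (Fin m) L :=
  MvPolynomial.aeval (fun l : Fin (m + 1) =>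
    Fin.lastCases (0 : MvPolynomial (Fin m) L) (fun l' => MvPolynomial.X l') l) P

/-- the inclusion `L⟦u₀,…,u_{n-1}⟧ → L⟦u₀,…,u_n⟧`. [folklore] -/
def inclLast (g : MvPowerSeries (Fin n) L) : MvPowerSeries (Fin (n + 1)) L :=
  MvPowerSeries.subst (fun j : Fin n => (MvPowerSeries.X (Fin.castSucc j) : MvPowerSeries (Fin (n + 1)) L)) g

/-- the graph substitution `u_j ↦ u_j (j < n), u_n ↦ η`. [folklore] -/
def graphSubst (η : MvPowerSeries (Fin n) L) (f : MvPowerSeries (Fin (n + 1)) L) : MvPowerSeries (Fin n) L :=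
  MvPowerSeries.subst (Fin.lastCases (motive := fun _ => MvPowerSeries (Fin n) L) η
    (fun j : Fin n => (MvPowerSeries.X j : MvPowerSeries (Fin n) L))) f

end Vocabulary

/-! ## The kit statements -/

/-- **Transform kit (the Euler transform identities for a general exceptional point, and the
exceptional restriction).** For a multiplicity-`p` state over a perfect field of characteristic `p`, with
`a = ser c`, `a' = ser (step i τ c)`, `σ = chartMap i τ`: `σ(∂_j a) = u_i^{p-1} ∂_j a'` (`j ≠ i`),
`σ(∂_i a) = u_i^{p-1}(u_i ∂_i a' − Σ_{j≠i}(u_j+τ_j)∂_j a')`, `σ(θa) = u_i^{p+1} ∂_i a'`; and modulo `u_i`,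
`∂_j a' ≡ (∂_jF)(ṽ)` (`j ≠ i`), `∂_i a' ≡ G(ṽ)`, where `F = form p p c`, `G = form p (p+1) c` and
`ṽ_l = u_l + τ_l` (`l ≠ i`), `ṽ_i = 1` (`σ(a) = u_iᵖ(a' + hᵖ)` — tree `exists_chartMap_ser_eq` —, `d` kills
`p`-th powers, chain rule `pd_subst`). [folklore] -/
def TransformKit : Prop :=
  ∀ p : ℕ, p.Prime → ∀ (n : ℕ) (L : Type) [Field L] [CharP L p] [PerfectField L]
    (c : (Fin n → ℕ) → L) (i : Fin n) (τ : Fin n → L), MultP p n L c →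
    let a := ser p n L c
    let a' := ser p n L (step p n L i τ c)
    let σ := chartMap n L i τ
    let ev : MvPolynomial (Fin n) L → MvPowerSeries (Fin n) L := evE i τ
    (∀ j, j ≠ i → σ (pd n L j a) = MvPowerSeries.X i ^ (p - 1) * pd n L j a') ∧
    σ (pd n L i a) = MvPowerSeries.X i ^ (p - 1) *
      (MvPowerSeries.X i * pd n L i a' -
        ∑ j ∈ Finset.univ.erase i, (MvPowerSeries.X j + MvPowerSeries.C (τ j) : MvPowerSeries (Fin n) L) * pd n L j a') ∧
    σ (∑ j, MvPowerSeries.X j * pd n L j a) = MvPowerSeries.X i ^ (p + 1) * pd n L i a' ∧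
    (∀ j, j ≠ i → MvPowerSeries.X i ∣ (pd n L j a' - ev (MvPolynomial.pderiv j (form p p c)))) ∧
    MvPowerSeries.X i ∣ (pd n L i a' - ev (form p (p + 1) c))

/-- **Automorphism kit.** For a substitution `Φ` of `L⟦u⟧` with zero constant terms and invertible
linear part `A` (`A j l = ` coefficient of `u_l` in `Φ j`, so `Φ(u) = A u + O(u²)`), the state `c ∘ Φ`
(coefficients of `(ser c)(Φ)`, i.e. of `a(Φ(u))`) has the same `Isol`, `MultP`, `mu`; its successor at an
exceptional point `q'` has the same `Isol`/`mu` as the successor of `c` at `q` whenever `A · pt q' ∥ pt q`;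
its tangent form is `F ∘ A` up to `p`-th-power monomials (so the partial derivatives agree) and its next
form is `G ∘ A + Σ_j (∂_j F ∘ A) · Φ_j⁽²⁾` (`Φ_j⁽²⁾` the quadratic part; degree `p+1` holds no `p`-th power)
(chain rule; the point blow-up is functorial: tree `stub_factorization`, `exists_chartPoint`). [folklore] -/
def AutKit : Prop :=
  ∀ p : ℕ, p.Prime → ∀ (n : ℕ) (L : Type) [Field L] [CharP L p]
    (c : (Fin n → ℕ) → L) (Φ : Fin n → MvPowerSeries (Fin n) L),
    (∀ j, MvPowerSeries.constantCoeff (Φ j) = 0) →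
    IsUnit (linPart Φ).det →
    let A : Matrix (Fin n) (Fin n) L := linPart Φ
    let cΦ : (Fin n → ℕ) → L := compState p c Φ
    let lin : MvPolynomial (Fin n) L → MvPolynomial (Fin n) L := linSubst A
    let quad : Fin n → MvPolynomial (Fin n) L := quadPart Φ
    (Isol p n L cΦ ↔ Isol p n L c) ∧ (MultP p n L cΦ ↔ MultP p n L c) ∧ mu p n L cΦ = mu p n L c ∧
    (∀ (q q' : Fin n × (Fin n → L)), (∃ s : L, s ≠ 0 ∧ A.mulVec (pt q') = s • pt q) →
        (Isol p n L (step p n L q'.1 q'.2 cΦ) ↔ Isol p n L (step p n L q.1 q.2 c)) ∧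
        mu p n L (step p n L q'.1 q'.2 cΦ) = mu p n L (step p n L q.1 q.2 c)) ∧
    (∀ j, MvPolynomial.pderiv j (form p p cΦ) = MvPolynomial.pderiv j (lin (form p p c))) ∧
    form p (p + 1) cΦ = lin (form p (p + 1) c) + ∑ j, lin (MvPolynomial.pderiv j (form p p c)) * quad j

/-- **Gauss avoidance (projective geometry of two forms).** Over an algebraically closed field of
characteristic `p`, in `m + 1 ≥ 2` variables (`0 < m`): if `Φ` is a form of degree `p`, `Ψ ≠ 0` a form, and the
projective scheme `V(∂₀Φ,…,∂ₘΦ, Ψ)` is finite (every dehomogenisation is finite-dimensional), then after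
an invertible linear change of coordinates the restrictions `Φ|, Ψ|` to the hyperplane `X_last = 0`
satisfy `Ψ| ≠ 0` and `V(∂(Φ|), Ψ|)` finite. (Points of the latter are the points `y ∈ V(Ψ) ∩ H` with
`dΦ_y ∥ λ_H` — `λ_H(y) = p·Φ(y)/c = 0` by Euler —; the `m+1` partials are algebraically dependent on each
component of the hypersurface `V(Ψ)`, so a homogeneous `R ≠ 0` vanishes on the Gauss image, and any `λ`
with `R(λ)·Ψ(λ(v)u − λ(u)v) ≠ 0` works.) [folklore] -/
def GaussAvoidance : Prop :=
  ∀ p : ℕ, p.Prime → ∀ m : ℕ, 0 < m → ∀ (L : Type) [Field L] [CharP L p] [IsAlgClosed L]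
    (Φ Ψ : MvPolynomial (Fin (m + 1)) L) (d : ℕ),
    Φ.IsHomogeneous p → Ψ.IsHomogeneous d → Ψ ≠ 0 →
    (∀ j, Module.Finite L (MvPolynomial (Fin (m + 1)) L ⧸
      (Ideal.span (insert Ψ (Set.range fun l => MvPolynomial.pderiv l Φ)) ⊔
        Ideal.span {MvPolynomial.X j - 1}))) →
    ∃ g : Matrix (Fin (m + 1)) (Fin (m + 1)) L, IsUnit g.det ∧
      let lin : MvPolynomial (Fin (m + 1)) L → MvPolynomial (Fin (m + 1)) L := linSubst g
      let res : MvPolynomial (Fin (m + 1)) L → MvPolynomial (Fin m) L := resLast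
      res (lin Ψ) ≠ 0 ∧
      ∀ j, Module.Finite L (MvPolynomial (Fin m) L ⧸
        (Ideal.span (insert (res (lin Ψ)) (Set.range fun l => MvPolynomial.pderiv l (res (lin Φ)))) ⊔
          Ideal.span {MvPolynomial.X j - 1}))


/-- **Section kit (graph elimination, formal implicit function, finite prime avoidance).** Over a field
of characteristic `p`, in `R = L⟦u₀,…,u_N⟧` (`N = n`, `u' = (u₀,…,u_{n-1})`, `R' = L⟦u'⟧`):
(i) for `η ∈ 𝔪'` the substitution `ρ_η : u_j ↦ u_j (j < N), u_N ↦ η` is onto `R'`, its kernel is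
`(u_N − η)`, colengths of `I + (u_N − η)` and of `ρ_η(I)` agree, and `∂_j ∘ ρ_η = ρ_η ∘ ∂_j` (`j < N`) when
`dη = 0`; (ii) for `h ∈ R` with no constant and no `u_N`-linear term there is `η ∈ 𝔪'` with
`η = ρ_η(h)`, and then `(u_N − h) = (u_N − η)` as ideals; (iii) for `a` with `R/(∂a)` finite, the set of
`λ` for which `R/(∂_{j<N} a, u_N + λ(∂_N a)^{2p})` is NOT finite over `L` is finite (a minimal prime of
`(∂_{j<N} a)` containing two such elements would contain `∂_N a`, hence all of `(∂a)`). [folklore] -/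
def SectionKit : Prop :=
  ∀ p : ℕ, p.Prime → ∀ (n : ℕ) (L : Type) [Field L] [CharP L p],
    let R := MvPowerSeries (Fin (n + 1)) L
    let R' := MvPowerSeries (Fin n) L
    let ι : R' → R := inclLast
    let ρ : R' → R → R' := graphSubst
    (∀ η : R', MvPowerSeries.constantCoeff η = 0 →
      Function.Surjective (ρ η) ∧
      (∀ f : R, ρ η f = 0 ↔ ((MvPowerSeries.X (Fin.last n) : R) - ι η) ∣ f) ∧
      (∀ I : Ideal R,
        (Module.Finite L (R ⧸ (I ⊔ Ideal.span {(MvPowerSeries.X (Fin.last n) : R) - ι η})) ↔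
          Module.Finite L (R' ⧸ Ideal.span (ρ η '' (I : Set R)))) ∧
        Module.finrank L (R ⧸ (I ⊔ Ideal.span {(MvPowerSeries.X (Fin.last n) : R) - ι η})) =
          Module.finrank L (R' ⧸ Ideal.span (ρ η '' (I : Set R)))) ∧
      ((∀ j, pd n L j η = 0) → ∀ (f : R) (j : Fin n),
        pd n L j (ρ η f) = ρ η (pd (n + 1) L (Fin.castSucc j) f))) ∧
    (∀ h : R, MvPowerSeries.constantCoeff h = 0 →
      MvPowerSeries.coeff (Finsupp.single (Fin.last n) 1) h = 0 →
      ∃ η : R', MvPowerSeries.constantCoeff η = 0 ∧ η = ρ η h ∧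
        Ideal.span {(MvPowerSeries.X (Fin.last n) : R) - h} = Ideal.span {(MvPowerSeries.X (Fin.last n) : R) - ι η}) ∧
    (∀ a : R, Module.Finite L (R ⧸ Ideal.span (Set.range fun j => pd (n + 1) L j a)) →
      Set.Finite {lam : L | ¬ Module.Finite L (R ⧸
        (Ideal.span (Set.range fun j : Fin n => pd (n + 1) L (Fin.castSucc j) a) ⊔
          Ideal.span {(MvPowerSeries.X (Fin.last n) : R) +
            (MvPowerSeries.C lam : R) * pd (n + 1) L (Fin.last n) a ^ (2 * p)}))})

/-- **The ONE-POINT BUDGET (what the crux needs).** Over an algebraically closed field of characteristic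
`p`: if `c` is isolated of multiplicity `p` with finite exceptional critical scheme (`ExcFinite`), then
`mu (step i τ c) ≤ mu c` at every exceptional point whose successor is isolated of multiplicity `p`. The
expected truth is the EQUALITY `Σ_{all Q ∈ E} mu_Q + Δ_n(p) = mu c` (censuses: slack `0` attained);
target of the line's `stub_exceptionalBudget`. [folklore] -/
def OnePointBudget : Prop :=
  ∀ p : ℕ, p.Prime → ∀ n : ℕ, 0 < n → ∀ (L : Type) [Field L] [CharP L p] [IsAlgClosed L]
    (c : (Fin n → ℕ) → L) (i : Fin n) (τ : Fin n → L),
    Isol p n L c → MultP p n L c → ExcFinite p c →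
    Isol p n L (step p n L i τ c) → MultP p n L (step p n L i τ c) →
    mu p n L (step p n L i τ c) ≤ mu p n L c

/-! ## The stub statements BY STUB NAME (`Sig.stub_<name>`; the skeleton audit admits a hypothesis of
the composition only when its head constant carries the stub's name) -/

/-- statement of `stub_sharedKits` (the three engines shared with crux stmt-18946). [folklore] -/
abbrev Sig.stub_sharedKits : Prop :=
  Summit.ResolutionOfSingularities.ResolutionOfSingularities.Theorems.JacobianBudget.BaseChange ∧
    Summit.ResolutionOfSingularities.ResolutionOfSingularities.Theorems.JacobianBudget.NoExcess ∧ PolarAdditivity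
/-- statement of `stub_mixedNoether` (shared with crux stmt-18946). [folklore] -/
abbrev Sig.stub_mixedNoether : Prop := MixedNoether
/-- statement of `stub_transformKit`. [folklore] -/
abbrev Sig.stub_transformKit : Prop := TransformKit
/-- statement of `stub_autKit`. [folklore] -/
abbrev Sig.stub_autKit : Prop := AutKit
/-- statement of `stub_gaussAvoidance`. [folklore] -/
abbrev Sig.stub_gaussAvoidance : Prop := GaussAvoidance
/-- statement of `stub_sectionKit`. [folklore] -/
abbrev Sig.stub_sectionKit : Prop := SectionKit
/-- statement of `stub_exceptionalBudget`: the one-point budget from the engines. [folklore] -/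
abbrev Sig.stub_exceptionalBudget : Prop :=
  TransformKit → PolarAdditivity → MixedNoether → GaussAvoidance → AutKit → SectionKit → OnePointBudget

end Summit.ResolutionOfSingularities.ResolutionOfSingularities.Theorems.BoundedMilnorBudget

end
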